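import Summits.Schanuel.Schanuel.Theorems.RootDecomp1EUnsaturatedCore01

/-!
# RootDecomp1E · round 13 (lens-2 «structural dichotomy», gen 13) — UNSATURATED CORE, part 2 of 4

Continuation of `RootDecomp1EUnsaturatedCore01`.  This part: §4 the certified cells: G = (πi, 1, i, π) collapses onto Lindemann's triple (1, i, π); §5 (b″) the certified OPEN member M₁ = (1, iπ, log 2) of PLAIN 31410 (up to `logTwoTriple_demand_of_pair`).  Source: lens-2 g13 `UnsaturatedCore.lean`
(sha256 0f7762d0…) lines 260–605 verbatim (namespace renamed `…Theses.UnsaturatedCore` →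
`…Theorems.RootDecomp1EUnsaturatedCore` for the Theorems tree); port `--supports stmt-Schanuel-25020`
(critic g6 cleared LOW).  Sorry-free; standard axioms; nothing here proves Schanuel (rung 0).
-/

noncomputable section

namespace Summit.Schanuel.Schanuel.Theorems.RootDecomp1EUnsaturatedCore

open Complex IntermediateField
open Summit.Schanuel.Schanuel.Theses.RootDecomp1E (DefectOneSchanuel SaturatedSchanuel PlainDefectOne
  ClosedFormAtomSchanuel AlgAnchoredDarkAtomSchanuel LineLogDarkAtomSchanuel DeepLogDarkAtomSchanuel
  OffAxisClosure FreeDarkAtomSchanuel)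
open Summit.Schanuel.Schanuel.Theorems.RootDecomp1EAnchor (isAlgebraic_of_mem_adjoin trdeg_adjoin_le_of_isAlgebraic
  trdeg_le_of_mem_span trdeg_eq_of_span_eq isAlgebraic_of_trdeg_sandwich gens_cons_isAlgebraic Saturated)
open Summit.Schanuel.Schanuel.Theorems.RootDecomp1EEngineType (trdeg_eq_nat two_le_trdeg_of_algebraicIndependent
  algebraicIndependent_pi_exp_pi)
open Summit.Schanuel.Schanuel.Theorems.RootDecomp1EModuleGrids (subMinimal_three rat_mul_pi_eq_rat
  rat_log_two_log_three_indep)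
open Summit.Schanuel.Schanuel.Theorems.RootDecomp1EModuleType (SubMinimalDefect)
open Summit.Schanuel.Schanuel.Theorems.RootDecomp1ELevels (le_trdeg_of_algebraicIndependent)
open Literature.NumberTheory.Transcendental (transcendental_exp_holds nesterenko exists_nsmul_mem_span_int
  ExpOneAddPiIrrational ExpOnePiAlgebraicIndependent)
open Literature.Barriers.Schanuel (AlgIndepLogarithms algIndepLogarithms_of_schanuel linearIndependent_piI_log_two
  algebraicIndependent_piI_log_two_of_algIndepLogarithms gridField₂ smallTrdeg_thm_2_9_two_two)

/-! ## §4 The lens at the certified cells: `G = (πi, 1, i, π)` collapses onto Lindemann's triple `(1, i, π)` -/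

/-- **LINDEMANN'S TRIPLE `(1, i, π)`** (exponentials `e, eⁱ, e^π`). -/
def lindemannTriple : Fin 3 → ℂ := ![1, I, (Real.pi : ℂ)]

/-- `(1, i, π)` is ℚ-free (`π ∉ ℚ`). -/
theorem lindemannTriple_linearIndependent : LinearIndependent ℚ lindemannTriple := by
  rw [Fintype.linearIndependent_iff]
  intro g hg
  simp only [Fin.sum_univ_three, lindemannTriple, Matrix.cons_val_zero, Matrix.cons_val_one,
    Matrix.cons_val_two, Matrix.tail_cons, Matrix.head_cons, Rat.smul_def] at hg
  have hre := congrArg Complex.re hg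
  have him := congrArg Complex.im hg
  simp only [Complex.add_re, Complex.add_im, Complex.mul_re, Complex.mul_im, Complex.ofReal_re,
    Complex.ofReal_im, Complex.I_re, Complex.I_im, Complex.ratCast_re, Complex.ratCast_im,
    Complex.zero_re, Complex.zero_im, mul_zero, zero_mul, add_zero,
    zero_add, mul_one, sub_zero, sub_self] at hre him
  have hπ : (g 2 : ℝ) * Real.pi = ((-g 0 : ℚ) : ℝ) := by push_cast; linear_combination hre
  obtain ⟨h2, h0⟩ := rat_mul_pi_eq_rat hπ
  intro i
  fin_cases i
  · simpa using h0
  · exact_mod_cast him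
  · exact h2

/-- `iπ ∉ span_ℚ (1, i, π)` (imaginary parts: `π ∉ ℚ`). -/
theorem piI_not_mem_span_lindemannTriple :
    (Real.pi : ℂ) * I ∉ Submodule.span ℚ (Set.range lindemannTriple) := by
  intro h
  obtain ⟨c, hc⟩ := (Submodule.mem_span_range_iff_exists_fun ℚ).mp h
  simp only [Fin.sum_univ_three, lindemannTriple, Matrix.cons_val_zero, Matrix.cons_val_one,
    Matrix.cons_val_two, Matrix.tail_cons, Matrix.head_cons, Rat.smul_def] at hc
  have him := congrArg Complex.im hc
  simp only [Complex.add_im, Complex.mul_im, Complex.ofReal_re, Complex.ofReal_im, Complex.I_re,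
    Complex.I_im, Complex.ratCast_re, Complex.ratCast_im, mul_zero,
    zero_mul, add_zero, zero_add, mul_one] at him
  have hπ : ((1 : ℚ) : ℝ) * Real.pi = ((c 1 : ℚ) : ℝ) := by push_cast; linear_combination -him
  exact one_ne_zero (rat_mul_pi_eq_rat hπ).1

/-- `iπ ∈ F_{(1,i,π)}` (product of two coordinates), hence algebraic over it. -/
theorem piI_isAlgebraic_lindemannTriple :
    IsAlgebraic ↥(adjoin ℚ (Set.range lindemannTriple ∪ Set.range (cexp ∘ lindemannTriple)))
      ((Real.pi : ℂ) * I) :=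
  isAlgebraic_of_mem_adjoin (mul_mem (subset_adjoin ℚ _ (Or.inl ⟨2, by simp [lindemannTriple]⟩))
    (subset_adjoin ℚ _ (Or.inl ⟨1, by simp [lindemannTriple]⟩)))

/-- `e^{iπ} = -1` is algebraic over `F_{(1,i,π)}`. -/
theorem exp_piI_isAlgebraic_lindemannTriple :
    IsAlgebraic ↥(adjoin ℚ (Set.range lindemannTriple ∪ Set.range (cexp ∘ lindemannTriple)))
      (cexp ((Real.pi : ℂ) * I)) := by
  rw [Complex.exp_pi_mul_I]
  exact isAlgebraic_of_mem_adjoin (neg_mem (one_mem _))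

/-- **`G = (πi, 1, i, π)`**, the certified E-stable biplane of gen 12, as a CONE over Lindemann's triple. -/
def gQuadruple : Fin 4 → ℂ := Fin.cons ((Real.pi : ℂ) * I) lindemannTriple

/-- `G` is ℚ-free. -/
theorem gQuadruple_linearIndependent : LinearIndependent ℚ gQuadruple :=
  linearIndependent_finCons.2 ⟨lindemannTriple_linearIndependent, piI_not_mem_span_lindemannTriple⟩

/-- `G` spans the same ℚ-space as gen 12's `![1, i, π, πi]`, so the two exponential fields have the same
transcendence degree (the gen-12 member and `gQuadruple` carry the same demand). -/
theorem trdeg_gQuadruple_eq_gen12 :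
    Algebra.trdeg ℚ ↥(adjoin ℚ (Set.range (![1, I, (Real.pi : ℂ), (Real.pi : ℂ) * I] : Fin 4 → ℂ) ∪
        Set.range (cexp ∘ (![1, I, (Real.pi : ℂ), (Real.pi : ℂ) * I] : Fin 4 → ℂ)))) =
      Algebra.trdeg ℚ ↥(adjoin ℚ (Set.range gQuadruple ∪ Set.range (cexp ∘ gQuadruple))) := by
  refine trdeg_eq_of_span_eq ?_ ?_
  · intro j
    fin_cases j
    · exact Submodule.subset_span ⟨1, by simp [gQuadruple, lindemannTriple]⟩
    · exact Submodule.subset_span ⟨2, by simp [gQuadruple, lindemannTriple]⟩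
    · exact Submodule.subset_span ⟨3, by simp [gQuadruple, lindemannTriple]⟩
    · exact Submodule.subset_span ⟨0, by simp [gQuadruple, lindemannTriple]⟩
  · intro i
    fin_cases i
    · exact Submodule.subset_span ⟨3, by simp [gQuadruple, lindemannTriple]⟩
    · exact Submodule.subset_span ⟨0, by simp [gQuadruple, lindemannTriple]⟩
    · exact Submodule.subset_span ⟨1, by simp [gQuadruple, lindemannTriple]⟩
    · exact Submodule.subset_span ⟨2, by simp [gQuadruple, lindemannTriple]⟩

/-- piece:proved · **COLLAPSE OF `G`.** The `S⁻`-demand at `G` (`4 ≤ trdeg ℚ(G, e^G) + 1`, what 31409 must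
deliver at its certified member) is EXACTLY full Schanuel at Lindemann's triple:
`trdeg_ℚ ℚ(π, e, eⁱ, e^π) ≥ 3`. -/
theorem gQuadruple_collapse :
    (((4 : ℕ) : Cardinal) ≤ Algebra.trdeg ℚ ↥(adjoin ℚ (Set.range gQuadruple ∪ Set.range (cexp ∘ gQuadruple))) + 1) ↔
      (((3 : ℕ) : Cardinal) ≤
        Algebra.trdeg ℚ ↥(adjoin ℚ (Set.range lindemannTriple ∪ Set.range (cexp ∘ lindemannTriple)))) :=
  defectOneAt_cons_iff lindemannTriple _ piI_isAlgebraic_lindemannTriple exp_piI_isAlgebraic_lindemannTriple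

/-- piece:reduction(c″) · the printed neighbour «`e, π, e^π` are algebraically independent» (a Schanuel
prediction, `= S₃(1, π, iπ)`) implies the collapsed `G`-demand. -/
theorem lindemann_demand_of_e_pi_exp_pi
    (h : AlgebraicIndependent ℚ ![cexp 1, (Real.pi : ℂ), cexp (Real.pi : ℂ)]) :
    ((3 : ℕ) : Cardinal) ≤
      Algebra.trdeg ℚ ↥(adjoin ℚ (Set.range lindemannTriple ∪ Set.range (cexp ∘ lindemannTriple))) := by
  refine le_trdeg_of_algebraicIndependent h ?_
  intro i
  fin_cases i
  · exact subset_adjoin ℚ _ (Or.inr ⟨0, by simp [lindemannTriple]⟩)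
  · exact subset_adjoin ℚ _ (Or.inl ⟨2, by simp [lindemannTriple]⟩)
  · exact subset_adjoin ℚ _ (Or.inr ⟨2, by simp [lindemannTriple]⟩)

/-- piece:reduction(c″) · the printed neighbour «`π, e, eⁱ` are algebraically independent» (Murty–Rath,
Thm 21.3 context: `π ⊥ e^{ℚ̄}`; `= S₃(1, i, iπ)`) implies the collapsed `G`-demand. -/
theorem lindemann_demand_of_e_pi_exp_I
    (h : AlgebraicIndependent ℚ ![cexp 1, (Real.pi : ℂ), cexp I]) :
    ((3 : ℕ) : Cardinal) ≤
      Algebra.trdeg ℚ ↥(adjoin ℚ (Set.range lindemannTriple ∪ Set.range (cexp ∘ lindemannTriple))) := by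
  refine le_trdeg_of_algebraicIndependent h ?_
  intro i
  fin_cases i
  · exact subset_adjoin ℚ _ (Or.inr ⟨0, by simp [lindemannTriple]⟩)
  · exact subset_adjoin ℚ _ (Or.inl ⟨2, by simp [lindemannTriple]⟩)
  · exact subset_adjoin ℚ _ (Or.inr ⟨1, by simp [lindemannTriple]⟩)

/-- piece:ceiling · what is KNOWN toward the collapsed `G`-demand `trdeg ℚ(π, e, eⁱ, e^π) ≥ 3`: TWO, by
Nesterenko (`π, e^π` algebraically independent; tree fact `nesterenko`, hypothesis form because its proof cone is
not built on the farm). The third is the open content (the e-side, cf. the wall below). -/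
theorem two_le_lindemann_demand (hN : nesterenko) :
    (2 : Cardinal) ≤
      Algebra.trdeg ℚ ↥(adjoin ℚ (Set.range lindemannTriple ∪ Set.range (cexp ∘ lindemannTriple))) := by
  refine two_le_trdeg_of_algebraicIndependent (algebraicIndependent_pi_exp_pi hN) ?_
  intro i
  fin_cases i
  · exact subset_adjoin ℚ _ (Or.inl ⟨2, by simp [lindemannTriple]⟩)
  · exact subset_adjoin ℚ _ (Or.inr ⟨2, by simp [lindemannTriple]⟩)

/-- piece:wall(a″) · **THE e-SIDE WALL.** Any unconditional progress placing `e` outside `ℚ(π)` — a tiny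
fragment of the collapsed `G`-demand — already proves `e + π ∉ ℚ` (open). -/
theorem irrational_exp_one_add_pi_of_not_mem (h : cexp 1 ∉ adjoin ℚ ({(Real.pi : ℂ)} : Set ℂ)) :
    Irrational (Real.exp 1 + Real.pi) := by
  rintro ⟨q, hq⟩
  apply h
  have he : cexp 1 = ((q : ℝ) : ℂ) - (Real.pi : ℂ) := by
    have h1 : cexp 1 = ((Real.exp 1 : ℝ) : ℂ) := by
      rw [Complex.ofReal_exp]
      simp
    rw [h1, show Real.exp 1 = (q : ℝ) - Real.pi by linarith]
    push_cast
    ring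
  rw [he]
  refine sub_mem ?_ (subset_adjoin ℚ _ (Set.mem_singleton _))
  have hq' : ((q : ℝ) : ℂ) = algebraMap ℚ ℂ q := by simp
  rw [hq']
  exact IntermediateField.algebraMap_mem _ q

/-! ## §5 (b″) The certified OPEN member `M₁ = (1, iπ, log 2)` of PLAIN 31410 -/

/-- `log 2 ∉ ℚ` (Hermite–Lindemann: `q ∈ ℚ ∖ 0 ⟹ e^q ∉ ℚ̄`, but `e^{log 2} = 2`). -/
theorem irrational_log_two : Irrational (Real.log 2) := by
  rintro ⟨q, hq⟩
  have hlog : Real.log 2 ≠ 0 := (Real.log_pos one_lt_two).ne'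
  have hq0 : (q : ℂ) ≠ 0 := by
    have : (q : ℝ) ≠ 0 := by rw [hq]; exact hlog
    exact_mod_cast this
  have halg : IsAlgebraic ℚ (q : ℂ) := by simpa using isAlgebraic_algebraMap (R := ℚ) (A := ℂ) q
  have ht := transcendental_exp_holds halg hq0
  apply ht
  have hexp : cexp (q : ℂ) = 2 := by
    rw [show (q : ℂ) = ((q : ℝ) : ℂ) by norm_cast, hq, ← Complex.ofReal_exp, Real.exp_log two_pos]
    norm_num
  rw [hexp]
  exact_mod_cast isAlgebraic_nat (R := ℚ) (A := ℂ) 2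

/-- **`M₁ = (1, iπ, log 2)`** (exponentials `e, -1, 2`). -/
def logTwoTriple : Fin 3 → ℂ := ![1, (Real.pi : ℂ) * I, (Real.log 2 : ℂ)]

/-- `M₁` is ℚ-free (imaginary parts: `π ≠ 0`; real parts: `log 2 ∉ ℚ`). -/
theorem logTwoTriple_linearIndependent : LinearIndependent ℚ logTwoTriple := by
  rw [Fintype.linearIndependent_iff]
  intro g hg
  simp only [Fin.sum_univ_three, logTwoTriple, Matrix.cons_val_zero, Matrix.cons_val_one,
    Matrix.cons_val_two, Matrix.tail_cons, Matrix.head_cons, Rat.smul_def] at hg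
  have hre := congrArg Complex.re hg
  have him := congrArg Complex.im hg
  simp only [Complex.add_re, Complex.add_im, Complex.mul_re, Complex.mul_im, Complex.ofReal_re,
    Complex.ofReal_im, Complex.I_re, Complex.I_im, Complex.ratCast_re, Complex.ratCast_im,
    Complex.zero_re, Complex.zero_im, mul_zero, zero_mul, add_zero,
    zero_add, mul_one, sub_zero, sub_self] at hre him
  have hπ : (g 1 : ℝ) * Real.pi = ((0 : ℚ) : ℝ) := by push_cast; linear_combination him
  have h1 : g 1 = 0 := (rat_mul_pi_eq_rat hπ).1
  have h2 : g 2 = 0 := by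
    by_contra h2
    have h2' : (g 2 : ℝ) ≠ 0 := by exact_mod_cast h2
    refine irrational_log_two ⟨-g 0 / g 2, ?_⟩
    push_cast
    rw [div_eq_iff h2']
    linear_combination -hre
  have h0 : g 0 = 0 := by
    rw [h2] at hre
    push_cast at hre
    simp only [zero_mul, add_zero] at hre
    exact_mod_cast hre
  intro i
  fin_cases i
  · exact h0
  · exact h1
  · exact h2

/-- **`M₁` has NO irrational algebraic multiplier** (it is PLAIN, the hypothesis of stmt-31410):
`β ∈ ℚ̄`, `β·M₁ ⊆ span_ℚ M₁ ⟹ β ∈ ℚ`. From `β·1 ∈ span`: `β = a + b·iπ + c·log 2`; imaginary parts of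
`β·iπ ∈ span` give `c·log 2 ∈ ℚ`, so `c = 0`; then `b·iπ = β - a ∈ ℚ̄` forces `b = 0` (Hermite–Lindemann:
`e^{iπ} = -1`). -/
theorem logTwoTriple_multiplier_rational (β : ℂ) (hβalg : IsAlgebraic ℚ β)
    (hβ : ∀ i, β * logTwoTriple i ∈ Submodule.span ℚ (Set.range logTwoTriple)) :
    β ∈ Set.range (algebraMap ℚ ℂ) := by
  obtain ⟨a, ha⟩ := (Submodule.mem_span_range_iff_exists_fun ℚ).mp (hβ 0)
  obtain ⟨b, hb⟩ := (Submodule.mem_span_range_iff_exists_fun ℚ).mp (hβ 1)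
  simp only [Fin.sum_univ_three, logTwoTriple, Matrix.cons_val_zero, Matrix.cons_val_one,
    Matrix.cons_val_two, Matrix.tail_cons, Matrix.head_cons, Rat.smul_def, mul_one] at ha hb
  have ha_re := congrArg Complex.re ha
  have ha_im := congrArg Complex.im ha
  have hb_im := congrArg Complex.im hb
  simp only [Complex.add_re, Complex.add_im, Complex.mul_re, Complex.mul_im, Complex.ofReal_re,
    Complex.ofReal_im, Complex.I_re, Complex.I_im, Complex.ratCast_re, Complex.ratCast_im,
    mul_zero, zero_mul, add_zero, zero_add, mul_one, sub_zero,
    sub_self] at ha_re ha_im hb_im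
  -- ha_re : a0 + a2·log 2 = Re β ;  hb_im : b1·π = Re β · π
  have hre : β.re = (b 1 : ℝ) := by
    have := hb_im
    exact (mul_right_cancel₀ Real.pi_ne_zero this).symm
  have h2 : a 2 = 0 := by
    by_contra h2
    have h2' : (a 2 : ℝ) ≠ 0 := by exact_mod_cast h2
    refine irrational_log_two ⟨(b 1 - a 0) / a 2, ?_⟩
    push_cast
    rw [div_eq_iff h2']
    linear_combination -ha_re - hre
  have hβ' : β = (a 0 : ℂ) + (a 1 : ℂ) * ((Real.pi : ℂ) * I) := by
    rw [← ha, h2]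
    push_cast
    ring
  have h1 : a 1 = 0 := by
    by_contra h1
    have h1' : (a 1 : ℂ) ≠ 0 := by exact_mod_cast h1
    have hπI : (Real.pi : ℂ) * I = (β - a 0) / a 1 := by
      rw [hβ']
      field_simp
      ring
    have hmem : (Real.pi : ℂ) * I ∈ algebraicClosure ℚ ℂ := by
      rw [hπI]
      refine div_mem (sub_mem (mem_algebraicClosure_iff.2 hβalg) ?_) ?_
      · simp
      · simp
    have halg : IsAlgebraic ℚ ((Real.pi : ℂ) * I) := mem_algebraicClosure_iff.1 hmem
    have hne : (Real.pi : ℂ) * I ≠ 0 := mul_ne_zero (by exact_mod_cast Real.pi_ne_zero) Complex.I_ne_zero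
    apply transcendental_exp_holds halg hne
    rw [Complex.exp_pi_mul_I]
    exact_mod_cast isAlgebraic_int (R := ℚ) (A := ℂ) (-1)
  refine ⟨a 0, ?_⟩
  rw [hβ', h1]
  simp

/-- piece:member(b″) · **`M₁` is a member of 31410's hypothesis class BY THEOREM**: ℚ-free, plain, sub-minimal
(`m ≤ 2` is the E-stable rung, tree theorem `subMinimal_three`). Hypothesis-free. -/
theorem logTwoTriple_mem_plainClass :
    LinearIndependent ℚ logTwoTriple ∧
      (∀ β : ℂ, IsAlgebraic ℚ β → (∀ i, β * logTwoTriple i ∈ Submodule.span ℚ (Set.range logTwoTriple)) →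
        β ∈ Set.range (algebraMap ℚ ℂ)) ∧ SubMinimalDefect 3 logTwoTriple :=
  ⟨logTwoTriple_linearIndependent, logTwoTriple_multiplier_rational, subMinimal_three _⟩

/-- What PLAIN 31410 must deliver at its member `M₁`. -/
theorem plainDefectOne_at_logTwoTriple (hP : PlainDefectOne) :
    ((3 : ℕ) : Cardinal) ≤
      Algebra.trdeg ℚ ↥(adjoin ℚ (Set.range logTwoTriple ∪ Set.range (cexp ∘ logTwoTriple))) + 1 :=
  hP 3 logTwoTriple logTwoTriple_linearIndependent logTwoTriple_multiplier_rational (subMinimal_three _)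

/-- Two generated subfields containing each other's generators have the same transcendence degree. -/
theorem trdeg_adjoin_eq_of_mem {S T : Set ℂ} (hST : ∀ x ∈ S, x ∈ adjoin ℚ T) (hTS : ∀ x ∈ T, x ∈ adjoin ℚ S) :
    Algebra.trdeg ℚ ↥(adjoin ℚ S) = Algebra.trdeg ℚ ↥(adjoin ℚ T) :=
  le_antisymm (trdeg_adjoin_le_of_isAlgebraic fun x hx => isAlgebraic_of_mem_adjoin (hST x hx))
    (trdeg_adjoin_le_of_isAlgebraic fun x hx => isAlgebraic_of_mem_adjoin (hTS x hx))

/-- `F_{M₁} = ℚ(1, iπ, log 2, e, -1, 2)` has the transcendence degree of `ℚ(e, iπ, log 2)`. -/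
theorem trdeg_logTwoTriple_eq :
    Algebra.trdeg ℚ ↥(adjoin ℚ (Set.range logTwoTriple ∪ Set.range (cexp ∘ logTwoTriple))) =
      Algebra.trdeg ℚ ↥(adjoin ℚ ({cexp 1, (Real.pi : ℂ) * I, (Real.log 2 : ℂ)} : Set ℂ)) := by
  have hexp2 : cexp (Real.log 2 : ℂ) = 2 := by
    rw [← Complex.ofReal_exp, Real.exp_log two_pos]
    norm_num
  refine trdeg_adjoin_eq_of_mem ?_ ?_
  · rintro x (⟨i, rfl⟩ | ⟨i, rfl⟩)
    · fin_cases i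
      · simp [logTwoTriple]
      · simpa [logTwoTriple] using
          (subset_adjoin ℚ ({cexp 1, (Real.pi : ℂ) * I, (Real.log 2 : ℂ)} : Set ℂ) (by simp) :
            (Real.pi : ℂ) * I ∈ _)
      · simpa [logTwoTriple] using
          (subset_adjoin ℚ ({cexp 1, (Real.pi : ℂ) * I, (Real.log 2 : ℂ)} : Set ℂ) (by simp) :
            (Real.log 2 : ℂ) ∈ _)
    · fin_cases i
      · simpa [logTwoTriple] using
          (subset_adjoin ℚ ({cexp 1, (Real.pi : ℂ) * I, (Real.log 2 : ℂ)} : Set ℂ) (by simp) : cexp 1 ∈ _)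
      · simp [logTwoTriple]
      · have : cexp (Real.log 2 : ℂ) ∈ adjoin ℚ ({cexp 1, (Real.pi : ℂ) * I, (Real.log 2 : ℂ)} : Set ℂ) := by
          rw [hexp2, show (2 : ℂ) = 1 + 1 by norm_num]; exact add_mem (one_mem _) (one_mem _)
        simpa [logTwoTriple] using this
  · intro x hx
    simp only [Set.mem_insert_iff, Set.mem_singleton_iff] at hx
    rcases hx with rfl | rfl | rfl
    · exact subset_adjoin ℚ _ (Or.inr ⟨0, by simp [logTwoTriple]⟩)
    · exact subset_adjoin ℚ _ (Or.inl ⟨1, by simp [logTwoTriple]⟩)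
    · exact subset_adjoin ℚ _ (Or.inl ⟨2, by simp [logTwoTriple]⟩)

/-- piece:member(b″) · **THE DEMAND OF 31410 AT `M₁`, DECODED**: `trdeg_ℚ ℚ(e, iπ, log 2) ≥ 2`, i.e. «at least
two of `e, π, log 2` are algebraically independent» — OPEN. -/
theorem logTwoTriple_demand_iff :
    (((3 : ℕ) : Cardinal) ≤
        Algebra.trdeg ℚ ↥(adjoin ℚ (Set.range logTwoTriple ∪ Set.range (cexp ∘ logTwoTriple))) + 1) ↔
      ((2 : Cardinal) ≤ Algebra.trdeg ℚ ↥(adjoin ℚ ({cexp 1, (Real.pi : ℂ) * I, (Real.log 2 : ℂ)} : Set ℂ))) := by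
  obtain ⟨t, ht, -⟩ := trdeg_eq_nat logTwoTriple
  rw [← trdeg_logTwoTriple_eq, ht]
  constructor
  · intro h
    have : 3 ≤ t + 1 := by exact_mod_cast h
    exact_mod_cast (show 2 ≤ t by omega)
  · intro h
    have : 2 ≤ t := by exact_mod_cast h
    exact_mod_cast (show 3 ≤ t + 1 by omega)

/-- piece:reduction(c″) · **`M₁` IS DECIDED modulo the registered printed conjecture `AlgIndepLogarithms`**
(algebraic independence of logarithms of algebraic numbers — strictly on the `𝓛`-side, weaker than `S` by the
tree theorem `algIndepLogarithms_of_schanuel`): it makes `iπ, log 2` algebraically independent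
(tree theorem `algebraicIndependent_piI_log_two_of_algIndepLogarithms`). -/
theorem logTwoTriple_demand_of_algIndepLogarithms (h : AlgIndepLogarithms) :
    ((3 : ℕ) : Cardinal) ≤
      Algebra.trdeg ℚ ↥(adjoin ℚ (Set.range logTwoTriple ∪ Set.range (cexp ∘ logTwoTriple))) + 1 := by
  have h2 : (2 : Cardinal) ≤
      Algebra.trdeg ℚ ↥(adjoin ℚ (Set.range logTwoTriple ∪ Set.range (cexp ∘ logTwoTriple))) := by
    refine two_le_trdeg_of_algebraicIndependent (algebraicIndependent_piI_log_two_of_algIndepLogarithms h) ?_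
    intro i
    fin_cases i
    · exact subset_adjoin ℚ _ (Or.inl ⟨1, by simp [logTwoTriple]⟩)
    · exact subset_adjoin ℚ _ (Or.inl ⟨2, by simp [logTwoTriple]⟩)
  calc ((3 : ℕ) : Cardinal) = 2 + 1 := by norm_num
    _ ≤ _ := add_le_add h2 le_rfl

/-- … any algebraically independent PAIR among `e, iπ, log 2` (each a famous open problem: `(e, π)`,
`(e, log 2)`, `(π, log 2)`) delivers the demand. -/
theorem logTwoTriple_demand_of_pair {v : Fin 2 → ℂ} (hv : AlgebraicIndependent ℚ v)
    (hmem : ∀ i, v i ∈ ({cexp 1, (Real.pi : ℂ) * I, (Real.log 2 : ℂ)} : Set ℂ)) :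
    ((3 : ℕ) : Cardinal) ≤
      Algebra.trdeg ℚ ↥(adjoin ℚ (Set.range logTwoTriple ∪ Set.range (cexp ∘ logTwoTriple))) + 1 := by
  rw [logTwoTriple_demand_iff]
  exact two_le_trdeg_of_algebraicIndependent hv fun i => subset_adjoin ℚ _ (hmem i)

end Summit.Schanuel.Schanuel.Theorems.RootDecomp1EUnsaturatedCore
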